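import Summits.NavierStokesRegularity.FluidComputer.PalasekTowerHeredityWitnessUnconditionalRungs
import Literature.Analysis.FluidPDE.ClassicalSolutionGlueIcc
import Literature.Analysis.FluidPDE.ClayForceTimeShift

/-!
# REGISTER v2.3′: the heredity witness — the WINDOW form (one window run extends the stage)

Cell `ns-blowup`, seat `ns-blowup-ecbridge-6` (g3; D-0074 GROUP C «BRIDGE SUPPORT»; bears_on LADDER-NS N1,
route `PalasekTowerBreakdown`, child crux item stmt-NavierStokesRegularity-19249 `HeredityAtOne`, its
parent 19178 `EpisodeInduction` = `EpisodeInductionG`, the sibling 19250 `HeredityFromTwo` and the base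
19179; supports only, nothing claimed). Companion of `PalasekTowerHeredityWitness.lean` (p417894:
`Schedule.LevelWitness`, `HeredityWitness k` — the DATUM form: the design's flow from `t = 0` to
`τ (k+1)`), `PalasekTowerHeredityWitnessUnconditional.lean` (p421753: the W14-free uniqueness
`velocity_eq_of_bounded_classical`, `Stage.exists_extends_of_velocity_continuation`) and
`PalasekTowerHeredityWitnessUnconditionalRungs.lean` (p423427). LABEL: E–C typing (KERNEL plumbing,
every statement proved; no definition, no named fact). WHAT THIS IS NOT: not Navier–Stokes evidence —
no stage, flow, tower or blow-up is constructed or asserted; the items stay OPEN and appear only as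
conclusions of implications / sides of equivalences whose hypotheses nobody has discharged.

## What is proved, and why this shape

§6 of HOME/ecbridge6/HEREDITY-WITNESS.md typed the witness in DATUM form (the design's flow
re-certified from `t = 0`) because a window run started AT `τ k` would have to be concatenated with
the stage at the CLOSED junction `τ k` (all-orders jet matching — not in the tree). The repair is an
OPEN OVERLAP: restart the window run at any time `τ k - ε` inside the stage's own slab. Then

* `velocity_eq_of_bounded_classical_Icc` (§1) — the W14-free uniqueness of p421753 RESTARTED at any
  time `a ≥ 0`: on a slab `[a, b]` two classical finite-energy solutions with the same Clay-class
  force and the same value at `a`, one of them bounded, coincide (time shift by `a`; the shifted force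
  is Clay-class by ecbridge-1 g5's `IsSmoothOnHalfSpace.timeShift` / `HasRapidSpaceTimeDecay.timeShift`,
  p429973);
* `Stage.exists_extends_of_window_continuation` (§2) — ANY rates, ANY viscosity, routeG margins, ANY
  level `k`: a classical solution `(v, q)` of the design's system on the window slab
  `[τ k - ε, τ (k+1)]` (`0 < ε ≤ τ k`) agreeing with the stage IN VELOCITY on the overlap
  `[τ k - ε, τ k]` (any pressure gauge), with finite energy on its slab, below `c₂ Y_{k+1}` on
  `[τ k, τ (k+1)]` and meeting the three level-`k+1` floors at `τ (k+1)`, EXTENDS the stage: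
  `∃ s', s.Extends s'`. Proof: the two pressures differ by a function of time on the open overlap
  (`IsClassicalNSSolutionOn.pressure_sub_apply_zero_eq_of_eventuallyEq`); re-gauge `q` by the Seeley
  extension of `t ↦ s.p t 0` (`exists_contDiffOn_Ici_extension`, p417894); glue along the open
  overlap (`IsClassicalNSSolutionOn.glue_Icc`, tree); hand the glued solution to p421753's
  `Stage.exists_extends_of_velocity_continuation`. NO uniqueness, NO named fact;
* `Stage.exists_extends_of_window_solution` (§3) — the same with the overlap agreement REPLACED by
  the restart datum `v (τ k - ε) = s.u (τ k - ε)` (`ν > 0`): the stage is the bounded competitor on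
  the overlap by its own ceiling `c₂ Y_k`, so §1 supplies the agreement;
* §4, unit viscosity / wide rates, by value: `heredityAt_iff_window_solutions` — `HeredityAt k` iff
  every registered level-`k` stage of every pinned rigid quiet design admits, for SOME `0 < ε ≤ τ k`,
  a window solution from its own state at `τ k - ε` with the ceiling and the floors;
  `heredityAtOne_iff_window_solutions` (item 19249), `heredityWitness_iff_window_solutions`.

So the certificate of one tower level is ONE WINDOW RUN of length `ε + (τ (k+1) - τ k)` restarted from
the stage's own state — the shape of the MODEL stage-2 runs («level 1 → 2 grown from the level-1
state»), now the exact ℝ³ statement; nothing on `[0, τ k - ε]` is re-certified. MODEL tower words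
remain ANALOGUES, never instances (HOME/cap/K1R-CAP-PRICE.md).

References: S. Palasek, arXiv:2605.13827 §4 [cite: Palasek2026ElementaryModel, §4]; H. Sohr, *The
Navier–Stokes Equations*, Birkhäuser 2001, Ch. V Thm. 1.5.1 [cite: Sohr2001, Ch. V Thm. 1.5.1];
R. T. Seeley, Proc. AMS 15 (1964) 625–626 [cite: Seeley1964, Theorem].
-/

noncomputable section

namespace Summit.NavierStokesRegularity.FluidComputer.PalasekTowerClayBridge

open Set MeasureTheory Filter Topology Function Real
open scoped ENNReal ContDiff NNReal
open Literature.Analysis.FluidPDE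

/-! ## §1 W14-free uniqueness restarted at a positive time -/

/-- **Bounded classical finite-energy solutions are unique among classical finite-energy solutions,
from any restart time `a ≥ 0`.** Clay-class force, `ν > 0`, `a < b`: two classical solutions of the
forced system on `[a, b] × ℝ³` with finite energy there and the same value at `t = a`, ONE OF WHICH
IS BOUNDED, coincide on `[a, b]` (time shift of p421753's `velocity_eq_of_bounded_classical`; the
shifted force `s ↦ f (s + a)` is Clay-class). [cite: Sohr2001, Ch. V Thm. 1.5.1] -/
theorem velocity_eq_of_bounded_classical_Icc {ν a b : ℝ} (hν : 0 < ν) (ha : 0 ≤ a) (hab : a < b)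
    {f u v : ℝ → EuclideanSpace ℝ (Fin 3) → EuclideanSpace ℝ (Fin 3)}
    {p q : ℝ → EuclideanSpace ℝ (Fin 3) → ℝ}
    (hs : IsSmoothOnHalfSpace f) (hd : HasRapidSpaceTimeDecay f)
    (hu : IsClassicalNSSolutionOn (Icc a b) ν f u p)
    (hEu : ∃ C : ℝ≥0∞, C < ⊤ ∧ ∀ t ∈ Icc a b, ∫⁻ x, ‖u t x‖ₑ ^ 2 ≤ C)
    {B : ℝ} (hB : ∀ t ∈ Icc a b, ∀ x, ‖u t x‖ ≤ B)
    (hv : IsClassicalNSSolutionOn (Icc a b) ν f v q)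
    (hEv : ∃ C : ℝ≥0∞, C < ⊤ ∧ ∀ t ∈ Icc a b, ∫⁻ x, ‖v t x‖ₑ ^ 2 ≤ C) (h0 : v a = u a) :
    ∀ t ∈ Icc a b, v t = u t := by
  set T : ℝ := b - a with hT
  have hTpos : 0 < T := by rw [hT]; linarith
  -- the shifted slab `[0, T]` maps into `[a, b]`
  have hmem : ∀ s ∈ Icc 0 T, s + a ∈ Icc a b := fun s hs =>
    ⟨by linarith [hs.1], by rw [hT] at hs; linarith [hs.2]⟩
  have hsub : Icc 0 T ⊆ (fun s => s + a) ⁻¹' Icc a b := fun s hs => hmem s hs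
  -- the shifted data
  have hs' : IsSmoothOnHalfSpace (fun s => f (s + a)) := hs.timeShift ha
  have hd' : HasRapidSpaceTimeDecay (fun s => f (s + a)) := hd.timeShift hs ha
  have hu' : IsClassicalNSSolutionOn (Icc 0 T) ν (fun s => f (s + a)) (fun s => u (s + a))
      (fun s => p (s + a)) := (hu.comp_add_right a).mono hsub (uniqueDiffOn_Icc hTpos)
  have hv' : IsClassicalNSSolutionOn (Icc 0 T) ν (fun s => f (s + a)) (fun s => v (s + a))
      (fun s => q (s + a)) := (hv.comp_add_right a).mono hsub (uniqueDiffOn_Icc hTpos)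
  have hEu' : ∃ C : ℝ≥0∞, C < ⊤ ∧ ∀ s ∈ Icc 0 T, ∫⁻ x, ‖u (s + a) x‖ₑ ^ 2 ≤ C := by
    obtain ⟨C, hC, h⟩ := hEu
    exact ⟨C, hC, fun s hs => h (s + a) (hmem s hs)⟩
  have hEv' : ∃ C : ℝ≥0∞, C < ⊤ ∧ ∀ s ∈ Icc 0 T, ∫⁻ x, ‖v (s + a) x‖ₑ ^ 2 ≤ C := by
    obtain ⟨C, hC, h⟩ := hEv
    exact ⟨C, hC, fun s hs => h (s + a) (hmem s hs)⟩
  have hB' : ∀ s ∈ Icc 0 T, ∀ x, ‖u (s + a) x‖ ≤ B := fun s hs x => hB (s + a) (hmem s hs) x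
  have h0' : (fun s => v (s + a)) 0 = (fun s => u (s + a)) 0 := by simpa using h0
  have heq := velocity_eq_of_bounded_classical hν hTpos hs' hd' hu' hEu' hB' hv' hEv' h0'
  intro t ht
  have hst : t - a ∈ Icc 0 T := ⟨by linarith [ht.1], by rw [hT]; linarith [ht.2]⟩
  have := heq (t - a) hst
  simpa only [sub_add_cancel] using this

/-! ## §2 A window continuation of a stage extends it (no uniqueness, no named fact) -/

namespace Stage

variable {ν : ℝ} {R : TowerRates} {S : Schedule R} {k : ℕ}

/-- The time slice `t ↦ w t x₀` of a jointly smooth field is smooth in time. [folklore] -/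
private theorem contDiffOn_slice {I : Set ℝ} {w : ℝ → EuclideanSpace ℝ (Fin 3) → ℝ}
    (hw : IsSmoothSpaceTimeOn I w) (x₀ : EuclideanSpace ℝ (Fin 3)) :
    ContDiffOn ℝ ∞ (fun t => w t x₀) I := by
  have hc : ContDiff ℝ ∞ (fun t : ℝ => ((t, x₀) : ℝ × EuclideanSpace ℝ (Fin 3))) :=
    contDiff_id.prodMk contDiff_const
  exact hw.comp hc.contDiffOn (fun t ht => mk_mem_prod ht (mem_univ _))

/-- **A WINDOW CONTINUATION EXTENDS THE STAGE** (any rates, any viscosity, routeG margins, any level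
`k`). Let `s` be a globally anchored registered stage at level `k` and `(v, q)` a classical solution
of the design's system `(ν, S.f)` on the window slab `[τ k - ε, τ (k+1)]`, `0 < ε ≤ τ k`, which agrees
with the stage IN VELOCITY on the overlap `[τ k - ε, τ k]` (any pressure gauge), has finite energy on
its slab, stays below `c₂ Y_{k+1}` on `[τ k, τ (k+1)]` and shows at `τ (k+1)`, in the ball, the three
level-`k+1` floors. Then `s` extends to a registered stage at level `k + 1`. The pressures differ by
a function of time on the open overlap; re-gauging `q` by the Seeley extension of `t ↦ s.p t 0` makes
them agree there; the tree's open-overlap gluing `IsClassicalNSSolutionOn.glue_Icc` produces a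
classical solution on `[0, τ (k+1)]` agreeing with the stage in velocity on `[0, τ k]`, and
`exists_extends_of_velocity_continuation` (p421753) assembles the stage. [folklore] -/
theorem exists_extends_of_window_continuation (s : Stage ν R S (Margins.routeG R) k)
    {ε : ℝ} (hε : 0 < ε) (hεk : ε ≤ S.τ k)
    {v : ℝ → EuclideanSpace ℝ (Fin 3) → EuclideanSpace ℝ (Fin 3)}
    {q : ℝ → EuclideanSpace ℝ (Fin 3) → ℝ}
    (hcl : IsClassicalNSSolutionOn (Icc (S.τ k - ε) (S.τ (k + 1))) ν S.f v q)
    (hagree : ∀ t ∈ Icc (S.τ k - ε) (S.τ k), v t = s.u t)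
    (henergy : ∃ C : ℝ≥0∞, C < ⊤ ∧
      ∀ t ∈ Icc (S.τ k - ε) (S.τ (k + 1)), ∫⁻ x, ‖v t x‖ₑ ^ 2 ≤ C)
    (hceilW : ∀ t ∈ Icc (S.τ k) (S.τ (k + 1)), ∀ x, ‖v t x‖ ≤ S.c₂ * R.Y (k + 1))
    (hfloor : ∃ x, ‖x‖ ≤ S.radius ∧ S.c₁ * R.Y (k + 1) ≤ ‖v (S.τ (k + 1)) x‖)
    (hstrain : ∃ x, ‖x‖ ≤ S.radius ∧ S.c₁ * R.A (k + 1) ≤ ‖fderiv ℝ (v (S.τ (k + 1))) x‖)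
    (hcore : ∃ (x : EuclideanSpace ℝ (Fin 3)) (γ : ℝ → EuclideanSpace ℝ (Fin 3)),
      ‖x‖ ≤ S.radius ∧ ContDiff ℝ 1 γ ∧ γ 0 = γ 1 ∧
      (∀ σ ∈ Icc (0 : ℝ) 1, γ σ ∈ Metric.closedBall x (1 / R.N (k + 1))) ∧
      (∀ σ ∈ Icc (0 : ℝ) 1, ‖deriv γ σ‖ ≤ 8 * π / R.N (k + 1)) ∧
      S.c₁ * R.N (k + 1) ^ (R.β - 2) ≤ circulation (v (S.τ (k + 1))) γ) :
    ∃ s' : Stage ν R S (Margins.routeG R) (k + 1), s.Extends s' := by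
  have hτk : 0 < S.τ k := S.τ_pos k
  have hτlt : S.τ k < S.τ (k + 1) := S.τ_lt_succ k
  have ha : 0 ≤ S.τ k - ε := by linarith
  -- the midpoint of the overlap, where the two pieces are switched
  set m : ℝ := S.τ k - ε / 2 with hm
  have ham : S.τ k - ε < m := by rw [hm]; linarith
  have hmb : m < S.τ k := by rw [hm]; linarith
  -- (1) the pressures differ by a function of time on the open overlap
  have hgauge : ∀ t ∈ Ioo (S.τ k - ε) (S.τ k), ∀ x, s.p t x - s.p t 0 = q t x - q t 0 := by
    intro t ht x
    have h1 : Icc 0 (S.τ k) ∈ 𝓝 t := Icc_mem_nhds (by linarith [ht.1]) ht.2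
    have h2 : Icc (S.τ k - ε) (S.τ (k + 1)) ∈ 𝓝 t := Icc_mem_nhds ht.1 (by linarith [ht.2])
    have hev : ∀ᶠ τ in 𝓝 t, s.u τ = v τ := by
      filter_upwards [Ioo_mem_nhds ht.1 ht.2] with τ hτ using (hagree τ ⟨hτ.1.le, hτ.2.le⟩).symm
    exact s.classical.pressure_sub_apply_zero_eq_of_eventuallyEq hcl h1 h2 hev x
  -- (2) the Seeley extension `e` of the stage's gauge `t ↦ s.p t 0` past `τ k`
  obtain ⟨e, he, hes⟩ :=
    exists_contDiffOn_Ici_extension hτk (contDiffOn_slice s.classical.smooth_pressure 0)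
  -- (3) the re-gauged window pressure `P t x = q t x - (q t 0 - e t)`
  set P : ℝ → EuclideanSpace ℝ (Fin 3) → ℝ := fun t x => q t x - (q t 0 - e t) with hP
  have hPcl : IsClassicalNSSolutionOn (Icc (S.τ k - ε) (S.τ (k + 1))) ν S.f v P := by
    refine ⟨hcl.smooth_velocity, ?_, ?_, hcl.divFree⟩
    · -- joint smoothness of `(t, x) ↦ q t x - (q t 0 - e t)`
      have hq0 : ContDiffOn ℝ ∞ (fun z : ℝ × EuclideanSpace ℝ (Fin 3) => q z.1 0)
          (Icc (S.τ k - ε) (S.τ (k + 1)) ×ˢ univ) :=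
        (contDiffOn_slice hcl.smooth_pressure 0).comp contDiff_fst.contDiffOn
          (fun z hz => (hz.1 : z.1 ∈ Icc (S.τ k - ε) (S.τ (k + 1))))
      have he' : ContDiffOn ℝ ∞ (fun z : ℝ × EuclideanSpace ℝ (Fin 3) => e z.1)
          (Icc (S.τ k - ε) (S.τ (k + 1)) ×ˢ univ) :=
        he.comp contDiff_fst.contDiffOn
          (fun z hz => (ha.trans (hz.1 : z.1 ∈ Icc (S.τ k - ε) (S.τ (k + 1))).1 : (0 : ℝ) ≤ z.1))
      exact ContDiffOn.sub hcl.smooth_pressure (hq0.sub he')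
    · intro t ht x
      have hg : gradient (P t) x = gradient (q t) x := gradient_sub_const (q t) (q t 0 - e t) x
      rw [hg]
      exact hcl.momentum t ht x
  -- on the open overlap the re-gauged pressure IS the stage's pressure
  have hPeq : ∀ t ∈ Ioo (S.τ k - ε) (S.τ k), P t = s.p t := by
    intro t ht
    funext x
    have h1 := hgauge t ht x
    have h2 : e t = s.p t 0 := hes ⟨by linarith [ht.1], ht.2.le⟩
    show q t x - (q t 0 - e t) = s.p t x
    linarith
  -- (4) glue the stage (on `[0, τ k]`) and the window piece along the open overlap
  have hglue := s.classical.glue_Icc hPcl ha ham hmb hτlt.le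
    (fun t ht => ⟨(hagree t ⟨ht.1.le, ht.2.le⟩).symm, (hPeq t ht).symm⟩)
  set U : ℝ → EuclideanSpace ℝ (Fin 3) → EuclideanSpace ℝ (Fin 3) :=
    fun t => if t ≤ m then s.u t else v t with hU
  set Q : ℝ → EuclideanSpace ℝ (Fin 3) → ℝ := fun t => if t ≤ m then s.p t else P t with hQ
  have hUcl : IsClassicalNSSolutionOn (Icc 0 (S.τ (k + 1))) ν S.f U Q := hglue
  have hUs : ∀ t, t ≤ m → U t = s.u t := fun t ht => by simp only [hU, if_pos ht]
  have hUv : ∀ t, m < t → U t = v t := fun t ht => by simp only [hU, if_neg (not_le.2 ht)]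
  -- velocity agreement with the stage on the whole old slab `[0, τ k]`
  have hvel : ∀ t ∈ Icc 0 (S.τ k), U t = s.u t := by
    intro t ht
    rcases le_or_gt t m with htm | htm
    · exact hUs t htm
    · rw [hUv t htm]
      exact hagree t ⟨by linarith, ht.2⟩
  -- finite energy on `[0, τ (k+1)]`
  have henergy' : ∃ C : ℝ≥0∞, C < ⊤ ∧ ∀ t ∈ Icc 0 (S.τ (k + 1)), ∫⁻ x, ‖U t x‖ₑ ^ 2 ≤ C := by
    obtain ⟨C₁, hC₁, hb₁⟩ := s.energy
    obtain ⟨C₂, hC₂, hb₂⟩ := henergy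
    refine ⟨max C₁ C₂, max_lt hC₁ hC₂, fun t ht => ?_⟩
    rcases le_or_gt t m with htm | htm
    · rw [hUs t htm]
      exact (hb₁ t ⟨ht.1, htm.trans hmb.le⟩).trans (le_max_left _ _)
    · rw [hUv t htm]
      exact (hb₂ t ⟨by linarith, ht.2⟩).trans (le_max_right _ _)
  -- the readout time lies in the window piece
  have hread : U (S.τ (k + 1)) = v (S.τ (k + 1)) := hUv _ (hmb.trans hτlt)
  have hceil' : ∀ t ∈ Icc (S.τ k) (S.τ (k + 1)), ∀ x, ‖U t x‖ ≤ S.c₂ * R.Y (k + 1) := by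
    intro t ht x
    rw [hUv t (hmb.trans_le ht.1)]
    exact hceilW t ht x
  refine s.exists_extends_of_velocity_continuation hUcl hvel henergy' hceil' ?_ ?_ ?_
  · rw [hread]; exact hfloor
  · rw [hread]; exact hstrain
  · rw [hread]; exact hcore

/-! ## §3 A window SOLUTION from the stage's own state extends it (`ν > 0`) -/

/-- **ONE WINDOW RUN EXTENDS THE STAGE** (any rates, any viscosity `ν > 0`, routeG margins, any level
`k`): as `exists_extends_of_window_continuation`, with the overlap agreement REPLACED by the restart
datum `v (τ k - ε) = s.u (τ k - ε)` — the stage is the bounded competitor on the overlap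
`[τ k - ε, τ k]` by its own register ceiling `‖s.u‖ ≤ c₂ Y_k` on `[0, τ k]`, so the window run
agrees with it there by `velocity_eq_of_bounded_classical_Icc` (forced Serrin–Masuda, W14-free).
[cite: Sohr2001, Ch. V Thm. 1.5.1] -/
theorem exists_extends_of_window_solution (hν : 0 < ν) (s : Stage ν R S (Margins.routeG R) k)
    {ε : ℝ} (hε : 0 < ε) (hεk : ε ≤ S.τ k)
    {v : ℝ → EuclideanSpace ℝ (Fin 3) → EuclideanSpace ℝ (Fin 3)}
    {q : ℝ → EuclideanSpace ℝ (Fin 3) → ℝ}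
    (hcl : IsClassicalNSSolutionOn (Icc (S.τ k - ε) (S.τ (k + 1))) ν S.f v q)
    (h0 : v (S.τ k - ε) = s.u (S.τ k - ε))
    (henergy : ∃ C : ℝ≥0∞, C < ⊤ ∧
      ∀ t ∈ Icc (S.τ k - ε) (S.τ (k + 1)), ∫⁻ x, ‖v t x‖ₑ ^ 2 ≤ C)
    (hceilW : ∀ t ∈ Icc (S.τ k) (S.τ (k + 1)), ∀ x, ‖v t x‖ ≤ S.c₂ * R.Y (k + 1))
    (hfloor : ∃ x, ‖x‖ ≤ S.radius ∧ S.c₁ * R.Y (k + 1) ≤ ‖v (S.τ (k + 1)) x‖)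
    (hstrain : ∃ x, ‖x‖ ≤ S.radius ∧ S.c₁ * R.A (k + 1) ≤ ‖fderiv ℝ (v (S.τ (k + 1))) x‖)
    (hcore : ∃ (x : EuclideanSpace ℝ (Fin 3)) (γ : ℝ → EuclideanSpace ℝ (Fin 3)),
      ‖x‖ ≤ S.radius ∧ ContDiff ℝ 1 γ ∧ γ 0 = γ 1 ∧
      (∀ σ ∈ Icc (0 : ℝ) 1, γ σ ∈ Metric.closedBall x (1 / R.N (k + 1))) ∧
      (∀ σ ∈ Icc (0 : ℝ) 1, ‖deriv γ σ‖ ≤ 8 * π / R.N (k + 1)) ∧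
      S.c₁ * R.N (k + 1) ^ (R.β - 2) ≤ circulation (v (S.τ (k + 1))) γ) :
    ∃ s' : Stage ν R S (Margins.routeG R) (k + 1), s.Extends s' := by
  have hτk : 0 < S.τ k := S.τ_pos k
  have hτlt : S.τ k < S.τ (k + 1) := S.τ_lt_succ k
  have ha : 0 ≤ S.τ k - ε := by linarith
  have hab : S.τ k - ε < S.τ k := by linarith
  -- both pieces restricted to the overlap slab `[τ k - ε, τ k]`
  have hsu : IsClassicalNSSolutionOn (Icc (S.τ k - ε) (S.τ k)) ν S.f s.u s.p :=
    s.classical.mono (Icc_subset_Icc ha le_rfl) (uniqueDiffOn_Icc hab)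
  have hsv : IsClassicalNSSolutionOn (Icc (S.τ k - ε) (S.τ k)) ν S.f v q :=
    hcl.mono (Icc_subset_Icc le_rfl hτlt.le) (uniqueDiffOn_Icc hab)
  have hEu : ∃ C : ℝ≥0∞, C < ⊤ ∧ ∀ t ∈ Icc (S.τ k - ε) (S.τ k), ∫⁻ x, ‖s.u t x‖ₑ ^ 2 ≤ C := by
    obtain ⟨C, hC, hb⟩ := s.energy
    exact ⟨C, hC, fun t ht => hb t ⟨ha.trans ht.1, ht.2⟩⟩
  have hEv : ∃ C : ℝ≥0∞, C < ⊤ ∧ ∀ t ∈ Icc (S.τ k - ε) (S.τ k), ∫⁻ x, ‖v t x‖ₑ ^ 2 ≤ C := by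
    obtain ⟨C, hC, hb⟩ := henergy
    exact ⟨C, hC, fun t ht => hb t ⟨ht.1, ht.2.trans hτlt.le⟩⟩
  have hB : ∀ t ∈ Icc (S.τ k - ε) (S.τ k), ∀ x, ‖s.u t x‖ ≤ S.c₂ * R.Y k :=
    fun t ht x => s.ceiling k le_rfl t ⟨ha.trans ht.1, ht.2⟩ x
  have hagree : ∀ t ∈ Icc (S.τ k - ε) (S.τ k), v t = s.u t :=
    velocity_eq_of_bounded_classical_Icc hν ha hab S.force_smooth S.force_decay hsu hEu hB hsv
      hEv h0
  exact s.exists_extends_of_window_continuation hε hεk hcl hagree henergy hceilW hfloor hstrain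
    hcore

/-- **Conversely, a stage one level up IS a window solution** from the lower stage's state, for
every `0 < ε ≤ τ k` (its own velocity and pressure restricted to the window slab). [folklore] -/
theorem Extends.window_solution (s : Stage ν R S (Margins.routeG R) k)
    (s' : Stage ν R S (Margins.routeG R) (k + 1)) (hss' : s.Extends s') {ε : ℝ} (hε : 0 < ε)
    (hεk : ε ≤ S.τ k) :
    IsClassicalNSSolutionOn (Icc (S.τ k - ε) (S.τ (k + 1))) ν S.f s'.u s'.p ∧
    s'.u (S.τ k - ε) = s.u (S.τ k - ε) ∧
    (∃ C : ℝ≥0∞, C < ⊤ ∧ ∀ t ∈ Icc (S.τ k - ε) (S.τ (k + 1)), ∫⁻ x, ‖s'.u t x‖ₑ ^ 2 ≤ C) ∧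
    (∀ t ∈ Icc (S.τ k) (S.τ (k + 1)), ∀ x, ‖s'.u t x‖ ≤ S.c₂ * R.Y (k + 1)) ∧
    (∃ x, ‖x‖ ≤ S.radius ∧ S.c₁ * R.Y (k + 1) ≤ ‖s'.u (S.τ (k + 1)) x‖) ∧
    (∃ x, ‖x‖ ≤ S.radius ∧ S.c₁ * R.A (k + 1) ≤ ‖fderiv ℝ (s'.u (S.τ (k + 1))) x‖) ∧
    (∃ (x : EuclideanSpace ℝ (Fin 3)) (γ : ℝ → EuclideanSpace ℝ (Fin 3)),
      ‖x‖ ≤ S.radius ∧ ContDiff ℝ 1 γ ∧ γ 0 = γ 1 ∧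
      (∀ σ ∈ Icc (0 : ℝ) 1, γ σ ∈ Metric.closedBall x (1 / R.N (k + 1))) ∧
      (∀ σ ∈ Icc (0 : ℝ) 1, ‖deriv γ σ‖ ≤ 8 * π / R.N (k + 1)) ∧
      S.c₁ * R.N (k + 1) ^ (R.β - 2) ≤ circulation (s'.u (S.τ (k + 1))) γ) := by
  have hτk : 0 < S.τ k := S.τ_pos k
  have hτlt : S.τ k < S.τ (k + 1) := S.τ_lt_succ k
  have ha : 0 ≤ S.τ k - ε := by linarith
  refine ⟨s'.classical.mono (Icc_subset_Icc ha le_rfl) (uniqueDiffOn_Icc (by linarith)),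
    (hss' (S.τ k - ε) ⟨ha, by linarith⟩).1, ?_, ?_, s'.floor (k + 1) le_rfl,
    s'.routeG_strain (k + 1) le_rfl, s'.routeG_coreLedger (k + 1) le_rfl⟩
  · obtain ⟨C, hC, hb⟩ := s'.energy
    exact ⟨C, hC, fun t ht => hb t ⟨ha.trans ht.1, ht.2⟩⟩
  · intro t ht x
    exact s'.ceiling (k + 1) le_rfl t ⟨hτk.le.trans ht.1, ht.2⟩ x

end Stage

/-! ## §4 Unit viscosity, wide rates: heredity, the first rung and the witness in WINDOW form -/

/-- **Heredity at level `k` ⇔ every registered level-`k` stage admits ONE WINDOW RUN**: for every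
pinned (`Λ = 8`, `θ = 6/5`), rigid, quiet design on the wide-base rates and every globally anchored
registered stage `s` at level `k` (unit viscosity), there are `0 < ε ≤ τ k` and a classical solution
`(v, q)` of the design's system on `[τ k - ε, τ (k+1)]` from the stage's own state
`v (τ k - ε) = s.u (τ k - ε)`, with finite energy there, below `(5/3) Y_{k+1}` on `[τ k, τ (k+1)]`,
meeting the three level-`k+1` floors at `τ (k+1)`. No hypothesis. [cite: Sohr2001, Ch. V Thm. 1.5.1] -/
theorem heredityAt_iff_window_solutions (k : ℕ) :
    HeredityAt k ↔ ∀ S : Schedule TowerRates.wide, S.Pins 8 (6 / 5) → S.Rigid → S.Quiet →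
      ∀ s : Stage 1 TowerRates.wide S (Margins.routeG TowerRates.wide) k,
        ∃ ε : ℝ, 0 < ε ∧ ε ≤ S.τ k ∧
        ∃ (v : ℝ → EuclideanSpace ℝ (Fin 3) → EuclideanSpace ℝ (Fin 3))
          (q : ℝ → EuclideanSpace ℝ (Fin 3) → ℝ),
          IsClassicalNSSolutionOn (Icc (S.τ k - ε) (S.τ (k + 1))) 1 S.f v q ∧
          v (S.τ k - ε) = s.u (S.τ k - ε) ∧
          (∃ C : ℝ≥0∞, C < ⊤ ∧ ∀ t ∈ Icc (S.τ k - ε) (S.τ (k + 1)), ∫⁻ x, ‖v t x‖ₑ ^ 2 ≤ C) ∧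
          (∀ t ∈ Icc (S.τ k) (S.τ (k + 1)), ∀ x, ‖v t x‖ ≤ S.c₂ * TowerRates.wide.Y (k + 1)) ∧
          (∃ x, ‖x‖ ≤ S.radius ∧ S.c₁ * TowerRates.wide.Y (k + 1) ≤ ‖v (S.τ (k + 1)) x‖) ∧
          (∃ x, ‖x‖ ≤ S.radius ∧
            S.c₁ * TowerRates.wide.A (k + 1) ≤ ‖fderiv ℝ (v (S.τ (k + 1))) x‖) ∧
          (∃ (x : EuclideanSpace ℝ (Fin 3)) (γ : ℝ → EuclideanSpace ℝ (Fin 3)),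
            ‖x‖ ≤ S.radius ∧ ContDiff ℝ 1 γ ∧ γ 0 = γ 1 ∧
            (∀ σ ∈ Icc (0 : ℝ) 1, γ σ ∈ Metric.closedBall x (1 / TowerRates.wide.N (k + 1))) ∧
            (∀ σ ∈ Icc (0 : ℝ) 1, ‖deriv γ σ‖ ≤ 8 * π / TowerRates.wide.N (k + 1)) ∧
            S.c₁ * TowerRates.wide.N (k + 1) ^ (TowerRates.wide.β - 2) ≤
              circulation (v (S.τ (k + 1))) γ) := by
  constructor
  · intro h S hP hR hQ s
    obtain ⟨s', hss'⟩ := h S hP hR hQ s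
    have hτk : 0 < S.τ k := S.τ_pos k
    obtain ⟨h1, h2, h3, h4, h5, h6, h7⟩ := Stage.Extends.window_solution s s' hss' hτk le_rfl
    exact ⟨S.τ k, hτk, le_rfl, s'.u, s'.p, h1, h2, h3, h4, h5, h6, h7⟩
  · intro h S hP hR hQ s
    obtain ⟨ε, hε, hεk, v, q, hcl, h0, henergy, hceil, hfloor, hstrain, hcore⟩ := h S hP hR hQ s
    exact s.exists_extends_of_window_solution one_pos hε hεk hcl h0 henergy hceil hfloor hstrain
      hcore

/-- **Item 19249 in WINDOW form**: `HeredityAtOne` ⇔ every registered level-`1` stage of every pinned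
rigid quiet wide design admits one window run on `[τ₁ - ε, τ₂]` from its own state at `τ₁ - ε`
(some `0 < ε ≤ τ₁`), finite energy, below `(5/3) Y₂` on `[τ₁, τ₂]`, with the level-`2` floors at
`τ₂`. No hypothesis. [cite: Sohr2001, Ch. V Thm. 1.5.1] -/
theorem heredityAtOne_iff_window_solutions :
    HeredityAtOne ↔ ∀ S : Schedule TowerRates.wide, S.Pins 8 (6 / 5) → S.Rigid → S.Quiet →
      ∀ s : Stage 1 TowerRates.wide S (Margins.routeG TowerRates.wide) 1,
        ∃ ε : ℝ, 0 < ε ∧ ε ≤ S.τ 1 ∧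
        ∃ (v : ℝ → EuclideanSpace ℝ (Fin 3) → EuclideanSpace ℝ (Fin 3))
          (q : ℝ → EuclideanSpace ℝ (Fin 3) → ℝ),
          IsClassicalNSSolutionOn (Icc (S.τ 1 - ε) (S.τ 2)) 1 S.f v q ∧
          v (S.τ 1 - ε) = s.u (S.τ 1 - ε) ∧
          (∃ C : ℝ≥0∞, C < ⊤ ∧ ∀ t ∈ Icc (S.τ 1 - ε) (S.τ 2), ∫⁻ x, ‖v t x‖ₑ ^ 2 ≤ C) ∧
          (∀ t ∈ Icc (S.τ 1) (S.τ 2), ∀ x, ‖v t x‖ ≤ S.c₂ * TowerRates.wide.Y 2) ∧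
          (∃ x, ‖x‖ ≤ S.radius ∧ S.c₁ * TowerRates.wide.Y 2 ≤ ‖v (S.τ 2) x‖) ∧
          (∃ x, ‖x‖ ≤ S.radius ∧ S.c₁ * TowerRates.wide.A 2 ≤ ‖fderiv ℝ (v (S.τ 2)) x‖) ∧
          (∃ (x : EuclideanSpace ℝ (Fin 3)) (γ : ℝ → EuclideanSpace ℝ (Fin 3)),
            ‖x‖ ≤ S.radius ∧ ContDiff ℝ 1 γ ∧ γ 0 = γ 1 ∧
            (∀ σ ∈ Icc (0 : ℝ) 1, γ σ ∈ Metric.closedBall x (1 / TowerRates.wide.N 2)) ∧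
            (∀ σ ∈ Icc (0 : ℝ) 1, ‖deriv γ σ‖ ≤ 8 * π / TowerRates.wide.N 2) ∧
            S.c₁ * TowerRates.wide.N 2 ^ (TowerRates.wide.β - 2) ≤ circulation (v (S.τ 2)) γ) :=
  heredityAtOne_iff.trans (heredityAt_iff_window_solutions 1)

/-- **The DATUM form and the WINDOW form of the witness agree, level by level**: `HeredityWitness k`
(p417894: the design's flow from `t = 0` to `τ (k+1)`) ⇔ the window form of `HeredityAt k`
(through `heredityAt_iff_heredityWitness'`, p423427, no hypothesis). [cite: Sohr2001, Ch. V Thm. 1.5.1] -/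
theorem heredityWitness_iff_window_solutions (k : ℕ) :
    HeredityWitness k ↔ ∀ S : Schedule TowerRates.wide, S.Pins 8 (6 / 5) → S.Rigid → S.Quiet →
      ∀ s : Stage 1 TowerRates.wide S (Margins.routeG TowerRates.wide) k,
        ∃ ε : ℝ, 0 < ε ∧ ε ≤ S.τ k ∧
        ∃ (v : ℝ → EuclideanSpace ℝ (Fin 3) → EuclideanSpace ℝ (Fin 3))
          (q : ℝ → EuclideanSpace ℝ (Fin 3) → ℝ),
          IsClassicalNSSolutionOn (Icc (S.τ k - ε) (S.τ (k + 1))) 1 S.f v q ∧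
          v (S.τ k - ε) = s.u (S.τ k - ε) ∧
          (∃ C : ℝ≥0∞, C < ⊤ ∧ ∀ t ∈ Icc (S.τ k - ε) (S.τ (k + 1)), ∫⁻ x, ‖v t x‖ₑ ^ 2 ≤ C) ∧
          (∀ t ∈ Icc (S.τ k) (S.τ (k + 1)), ∀ x, ‖v t x‖ ≤ S.c₂ * TowerRates.wide.Y (k + 1)) ∧
          (∃ x, ‖x‖ ≤ S.radius ∧ S.c₁ * TowerRates.wide.Y (k + 1) ≤ ‖v (S.τ (k + 1)) x‖) ∧
          (∃ x, ‖x‖ ≤ S.radius ∧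
            S.c₁ * TowerRates.wide.A (k + 1) ≤ ‖fderiv ℝ (v (S.τ (k + 1))) x‖) ∧
          (∃ (x : EuclideanSpace ℝ (Fin 3)) (γ : ℝ → EuclideanSpace ℝ (Fin 3)),
            ‖x‖ ≤ S.radius ∧ ContDiff ℝ 1 γ ∧ γ 0 = γ 1 ∧
            (∀ σ ∈ Icc (0 : ℝ) 1, γ σ ∈ Metric.closedBall x (1 / TowerRates.wide.N (k + 1))) ∧
            (∀ σ ∈ Icc (0 : ℝ) 1, ‖deriv γ σ‖ ≤ 8 * π / TowerRates.wide.N (k + 1)) ∧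
            S.c₁ * TowerRates.wide.N (k + 1) ^ (TowerRates.wide.β - 2) ≤
              circulation (v (S.τ (k + 1))) γ) :=
  (heredityAt_iff_heredityWitness' (k := k)).symm.trans (heredityAt_iff_window_solutions k)

end Summit.NavierStokesRegularity.FluidComputer.PalasekTowerClayBridge

end
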